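import Literature.AnabelianGeometry.AbsoluteAnabelian.AbsTopIII.CcnTransgression
import Literature.NumberTheory.GaloisRepresentations.ProfiniteCrossSection
import HarnessLib

/-!
# [AbsTopIII] Prop. 1.4 (ii) / Thm. 1.9 (b): the natural synchronization `I_x → M_X`, its existence data and equivariance

Mochizuki, *Topics in Absolute Anabelian Geometry III*, §1, Prop. 1.4 (ii) pp. 31–32 and Thm. 1.9 (b)
p. 37 (lit key `paper:url-5493eb38cbb7`): "this last element corresponds to the natural isomorphism
`M_X ⥲ I_x`"; "One constructs the natural isomorphisms `I_z ⥲ μ_Ẑ(Π_U) := M_Z` [...] via the technique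
of Proposition 1.4, (ii)."

Companion of `CcnTransgression.lean` (the differential `d : Hom_cont(Ker, Λ) → H²(Δ_X, Λ)` of the
central extension `1 → M_X^{c-cn} → Δ^{c-cn}_{U_x} → Δ_X → 1`, its independence of the section, the
synchronization `synchronizationOfBijective` of the kernel, the named fact
`CurveModel.Prop_1_4_ii_transgression`).  This file adds, all PROVED:

* `nonempty_ccnSection` — continuous sections of `Δ^{c-cn}_{U_x} ↠ Δ_X` EXIST when `Δ_{U_x} ↠ Δ_X`
  (trunk `ProfiniteCrossSection.lean`: closed subgroups of profinite groups admit continuous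
  sections, [Serre, Galois Cohomology, I §1.2 Prop. 1]; composed with `Δ_{U_x}/(N ∩ Δ) ≃ₜ Δ_X`), so the
  section datum is always available and `Prop_1_4_ii_transgression` is not vacuous;
* `inertiaToExtKer`, `inertiaSynchronization` — **the synchronization `I_x → M_X = Hom(H²(Δ_X, Ẑ), Ẑ)`**
  on an inertia group `I_x ≤ N`, `i ↦ (ξ ↦ (d⁻¹ ξ)(ī))`, independent of the section;
* `geomH2Map_ccnTransgression` — **equivariance of the differential**: `H²(c_{q g})(d χ) = d(χ ∘ conj_ḡ)`
  for `g ∈ Π_{U_x}` (from abc-iut-L4-t16's naturality of the generic transgression: pull-back,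
  independence of the lift, push-forward along the morphism of extensions `(conj_ḡ, c_{q g})`);
* `inertiaSynchronization_conj` — **the synchronization is `Π_{U_x}`-equivariant**:
  `sync(g i g⁻¹) = g · sync(i)` (`Π_{U_x}` acting on `M_X` through `Π_X` and `H²(c_g)`), i.e. the
  naturality behind Thm. 1.9 (b)'s "natural isomorphisms", leaving only bijectivity
  (`Prop_1_4_ii_transgression`, `IsCuspidallyCentralExtension`, `I_x ≅ Ẑ`) as named input.

HONEST FRAMING: elementary profinite group cohomology over the interface; nothing here bears on
[IUTchIII] Cor. 3.12.
-/

noncomputable section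

open CategoryTheory

universe u

namespace Literature.AnabelianGeometry.AbsoluteAnabelian.AbsTopIII

variable {E F : FundamentalExtension.{u}} (q : E ⟶ F)
variable (Λ : Type u) [AddCommGroup Λ] [TopologicalSpace Λ] [IsTopologicalAddGroup Λ]

/-! ### Existence of continuous sections of `Δ^{c-cn}_{U_x} ↠ Δ_X` (profinite groups) -/

section SectionExistence

/-- `N ∩ Δ_{U_x}` as a subgroup of `Δ_{U_x}` (closed, normal).
[cite: MochizukiAbsTopIII2015, Prop 1.4 (ii) p.31] -/
abbrev geomKer : Subgroup E.geom := (cuspidalKernel q).subgroupOf E.geom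

/-- `Δ_{U_x} → Δ_X`, the restriction of `q`. [cite: MochizukiAbsTopIII2015, Prop 1.4 (ii) p.31] -/
def geomRestr : E.geom →* F.geom where
  toFun g := ⟨q.arith g, q.mapsTo_geom g.2⟩
  map_one' := Subtype.ext (by simp)
  map_mul' g h := Subtype.ext (by simp)

/-- Value of `geomRestr`. [cite: MochizukiAbsTopIII2015, Prop 1.4 (ii) p.31] -/
@[simp] theorem coe_geomRestr (g : E.geom) : ((geomRestr q g : F.geom) : F.arith) = q.arith g := rfl

/-- `geomRestr` is continuous. [cite: MochizukiAbsTopIII2015, Prop 1.4 (ii) p.31] -/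
theorem continuous_geomRestr : Continuous (geomRestr q) :=
  Continuous.subtype_mk (q.arith.continuous.comp continuous_subtype_val) _

/-- `N ∩ Δ ≤ Ker(Δ_{U_x} → Δ_X)`. [cite: MochizukiAbsTopIII2015, Prop 1.4 (ii) p.31] -/
theorem geomKer_le_ker : geomKer q ≤ (geomRestr q).ker := by
  intro g hg
  rw [MonoidHom.mem_ker]
  apply Subtype.ext
  change q.arith g = 1
  exact (Subgroup.mem_subgroupOf.mp hg).1

/-- `Δ_{U_x}/(N ∩ Δ) → Δ_X` induced by `q`. [cite: MochizukiAbsTopIII2015, Prop 1.4 (ii) p.31] -/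
def geomQuotLift : E.geom ⧸ geomKer q →* F.geom :=
  QuotientGroup.lift (geomKer q) (geomRestr q) (geomKer_le_ker q)

/-- `geomQuotLift` on classes. [cite: MochizukiAbsTopIII2015, Prop 1.4 (ii) p.31] -/
@[simp] theorem geomQuotLift_mk (g : E.geom) :
    geomQuotLift q (QuotientGroup.mk g) = geomRestr q g :=
  QuotientGroup.lift_mk _ _ g

/-- `geomQuotLift` is continuous. [cite: MochizukiAbsTopIII2015, Prop 1.4 (ii) p.31] -/
theorem continuous_geomQuotLift : Continuous (geomQuotLift q) := by
  rw [← QuotientGroup.isOpenQuotientMap_mk.continuous_comp_iff]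
  have : (geomQuotLift q) ∘ (QuotientGroup.mk : E.geom → E.geom ⧸ geomKer q) = geomRestr q := by
    funext g
    exact geomQuotLift_mk q g
  rw [this]
  exact continuous_geomRestr q

/-- `geomQuotLift` is bijective when `q` maps `Δ_{U_x}` onto `Δ_X`.
[cite: MochizukiAbsTopIII2015, Prop 1.4 (ii) p.31] -/
theorem geomQuotLift_bijective (hq : Set.SurjOn q.arith E.geom F.geom) :
    Function.Bijective (geomQuotLift q) := by
  constructor
  · intro a b hab
    induction a using QuotientGroup.induction_on with
    | H a =>
      induction b using QuotientGroup.induction_on with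
      | H b =>
        rw [geomQuotLift_mk, geomQuotLift_mk] at hab
        rw [QuotientGroup.eq, Subgroup.mem_subgroupOf]
        refine ⟨?_, (a⁻¹ * b).2⟩
        have hab' := congrArg (fun z : F.geom => (z : F.arith)) hab
        simp only [coe_geomRestr] at hab'
        change q.arith ((a : E.arith)⁻¹ * b) = 1
        rw [map_mul, map_inv, hab', inv_mul_cancel]
  · rintro ⟨d, hd⟩
    obtain ⟨g, hg, hgd⟩ := hq hd
    exact ⟨QuotientGroup.mk ⟨g, hg⟩, Subtype.ext (by simpa using hgd)⟩

/-- `Δ_{U_x}/(N ∩ Δ) ≃ₜ Δ_X` (continuous bijection from a compact space to a Hausdorff space).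
[cite: MochizukiAbsTopIII2015, Prop 1.4 (ii) p.31] -/
def geomQuotHomeo (hq : Set.SurjOn q.arith E.geom F.geom) : (E.geom ⧸ geomKer q) ≃ₜ F.geom :=
  haveI : CompactSpace E.geom := isCompact_iff_compactSpace.mp E.isClosed_geom.isCompact
  Continuous.homeoOfEquivCompactToT2 (f := Equiv.ofBijective _ (geomQuotLift_bijective q hq))
    (continuous_geomQuotLift q)

/-- Value of `geomQuotHomeo`. [cite: MochizukiAbsTopIII2015, Prop 1.4 (ii) p.31] -/
theorem geomQuotHomeo_apply (hq : Set.SurjOn q.arith E.geom F.geom) (c : E.geom ⧸ geomKer q) :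
    geomQuotHomeo q hq c = geomQuotLift q c :=
  rfl

/-- **Continuous sections of `Δ^{c-cn}_{U_x} ↠ Δ_X` EXIST** when `q` maps `Δ_{U_x}` onto `Δ_X` (closed
subgroups of profinite groups admit continuous sections — the trunk's
`exists_continuous_section_of_isClosed`, [Serre, Galois Cohomology, I §1.2 Prop. 1] — composed with
`Δ_{U_x}/(N ∩ Δ) ≃ₜ Δ_X` and `Δ_{U_x} → Δ^{c-cn}_{U_x}`).  So the section datum of `ccnTransgression` is
always available and `Prop_1_4_ii_transgression` is not vacuous.
[cite: MochizukiAbsTopIII2015, Prop 1.4 (ii) p.31] -/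
theorem nonempty_ccnSection (hq : Set.SurjOn q.arith E.geom F.geom) : Nonempty (CcnSection q) := by
  haveI : CompactSpace E.geom := isCompact_iff_compactSpace.mp E.isClosed_geom.isCompact
  have hclosed : IsClosed (geomKer q : Set E.geom) := by
    have h1 : IsClosed (cuspidalKernel q : Set E.arith) := by
      unfold cuspidalKernel
      exact (isClosed_singleton.preimage q.arith.continuous).inter E.isClosed_geom
    exact h1.preimage continuous_subtype_val
  obtain ⟨s₀, hs₀, hsec⟩ :=
    Literature.NumberTheory.GaloisRepresentations.exists_continuous_section_of_isClosed
      (geomKer q) hclosed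
  let e := geomQuotHomeo q hq
  refine ⟨{ toFun := ⟨fun d => ⟨QuotientGroup.mk ((s₀ (e.symm d) : E.geom) : E.arith),
      Subgroup.mem_map.mpr ⟨_, (s₀ (e.symm d)).2, rfl⟩⟩, ?_⟩, proj_apply := fun d => ?_ }⟩
  · exact Continuous.subtype_mk (QuotientGroup.continuous_mk.comp
      (continuous_subtype_val.comp (hs₀.comp e.symm.continuous))) _
  · apply Subtype.ext
    change ccnProj q (QuotientGroup.mk ((s₀ (e.symm d) : E.geom) : E.arith)) = (d : F.arith)
    rw [ccnProj_mk]
    have h1 : (geomRestr q (s₀ (e.symm d)) : F.arith) = q.arith ((s₀ (e.symm d) : E.geom) : E.arith) :=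
      rfl
    rw [← h1, ← geomQuotLift_mk, hsec, ← geomQuotHomeo_apply q hq, Homeomorph.apply_symm_apply]

end SectionExistence

/-! ### The synchronization on an inertia group `I_x ≤ N`: `I_x → M_X` -/

section Inertia

variable {q} {I : Subgroup E.arith}

/-- `I_x → Ker(Δ^{c-cn}_{U_x} ↠ Δ_X)` for `I_x ≤ N` (the restriction of `Π_{U_x} ↠ Π_{U_x}/[N, Δ]⁻`).
[cite: MochizukiAbsTopIII2015, Prop 1.4 (ii) p.31] -/
def inertiaToExtKer (hI : I ≤ cuspidalKernel q) :
    I →* ContinuousCohomology.extKer (deltaCcnProjₜ q) where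
  toFun i := ⟨⟨QuotientGroup.mk (i : E.arith),
      Subgroup.mem_map.mpr ⟨i, cuspidalKernel_le_geom q (hI i.2), rfl⟩⟩, by
    rw [extKer_deltaCcnProjₜ, Subgroup.mem_subgroupOf]
    exact Subgroup.mem_map.mpr ⟨i, hI i.2, rfl⟩⟩
  map_one' := Subtype.ext (Subtype.ext (by simp))
  map_mul' i j := Subtype.ext (Subtype.ext (by simp))

/-- Value of `inertiaToExtKer`. [cite: MochizukiAbsTopIII2015, Prop 1.4 (ii) p.31] -/
@[simp] theorem coe_coe_inertiaToExtKer (hI : I ≤ cuspidalKernel q) (i : I) :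
    (((inertiaToExtKer hI i : ContinuousCohomology.extKer (deltaCcnProjₜ q)) : DeltaCcn q) :
        CuspidallyCentralQuotient q) = QuotientGroup.mk (i : E.arith) :=
  rfl

/-- `inertiaToExtKer` is continuous. [cite: MochizukiAbsTopIII2015, Prop 1.4 (ii) p.31] -/
theorem continuous_inertiaToExtKer (hI : I ≤ cuspidalKernel q) : Continuous (inertiaToExtKer hI) :=
  Continuous.subtype_mk (Continuous.subtype_mk
    (QuotientGroup.continuous_mk.comp continuous_subtype_val) _) _

variable (q) in
/-- **The synchronization `I_x → M_X = Hom(H²(Δ_X, Ẑ), Ẑ)`** of Prop. 1.4 (ii) / Thm. 1.9 (b)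
("the natural isomorphisms `I_z ⥲ μ_Ẑ(Π_U) := M_Z` [...] via the technique of Proposition 1.4, (ii)",
p. 37): the natural synchronization of the kernel composed with `I_x → Ker(Δ^{c-cn}_{U_x} ↠ Δ_X)`;
relative to a section and a bijectivity witness of the differential, independent of the section
(`inertiaSynchronization_eq`).  (That it is an ISOMORPHISM for a cyclotome presentation is the content
of `IsCuspidallyCentralExtension` + `Prop_1_4_ii_transgression` + `I_x ≅ Ẑ`; not proved here.)
[cite: MochizukiAbsTopIII2015, Thm 1.9 (b) p.37] -/
def inertiaSynchronization (hI : I ≤ cuspidalKernel q) (s : CcnSection q)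
    (hd : Function.Bijective (ccnTransgression q ZHatCoeff.{u} s)) :
    Additive I →+ geomCyclotomeDual F ZHatCoeff.{u} :=
  (synchronizationOfBijective q s hd).comp (MonoidHom.toAdditive (inertiaToExtKer hI))

/-- Formula. [cite: MochizukiAbsTopIII2015, Thm 1.9 (b) p.37] -/
theorem inertiaSynchronization_apply (hI : I ≤ cuspidalKernel q) (s : CcnSection q)
    (hd : Function.Bijective (ccnTransgression q ZHatCoeff.{u} s)) (i : I)
    (ξ : geomH2 F ZHatCoeff.{u}) :
    inertiaSynchronization q hI s hd (Additive.ofMul i) ξ =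
      (AddEquiv.ofBijective _ hd).symm ξ (Additive.ofMul (inertiaToExtKer hI i)) :=
  rfl

/-- **Naturality**: independent of the section. [cite: MochizukiAbsTopIII2015, Thm 1.9 (b) p.37] -/
theorem inertiaSynchronization_eq (hI : I ≤ cuspidalKernel q) (s s' : CcnSection q)
    (hd : Function.Bijective (ccnTransgression q ZHatCoeff.{u} s))
    (hd' : Function.Bijective (ccnTransgression q ZHatCoeff.{u} s')) :
    inertiaSynchronization q hI s hd = inertiaSynchronization q hI s' hd' := by
  unfold inertiaSynchronization
  rw [synchronizationOfBijective_eq q s s' hd hd']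

end Inertia

/-! ### Equivariance of the differential and of the synchronization under `Π_{U_x}` -/

section Equivariance

/-- `Δ^{c-cn}_{U_x}` is normal in `Π_{U_x}/[N, Δ]⁻`. [cite: MochizukiAbsTopIII2015, Prop 1.4 (ii) p.31] -/
instance deltaCcn_normal : (DeltaCcn q).Normal :=
  Subgroup.Normal.map inferInstance _ (QuotientGroup.mk'_surjective _)

/-- Conjugation by (the image of) `g ∈ Π_{U_x}` on `Δ^{c-cn}_{U_x}`.
[cite: MochizukiAbsTopIII2015, Prop 1.4 (ii) p.31] -/
def ccnConj (g : E.arith) : DeltaCcn q →ₜ* DeltaCcn q where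
  toFun y := ⟨(QuotientGroup.mk g : CuspidallyCentralQuotient q) * (y : CuspidallyCentralQuotient q) *
      (QuotientGroup.mk g)⁻¹, (deltaCcn_normal q).conj_mem _ y.2 _⟩
  map_one' := Subtype.ext (by simp)
  map_mul' y z := Subtype.ext (by
    simp only [Subgroup.coe_mul]
    group)
  continuous_toFun :=
    ((continuous_const.mul continuous_subtype_val).mul continuous_const).subtype_mk _

/-- Value of `ccnConj`. [cite: MochizukiAbsTopIII2015, Prop 1.4 (ii) p.31] -/
@[simp] theorem coe_ccnConj_apply (g : E.arith) (y : DeltaCcn q) :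
    ((ccnConj q g y : DeltaCcn q) : CuspidallyCentralQuotient q) =
      (QuotientGroup.mk g : CuspidallyCentralQuotient q) * (y : CuspidallyCentralQuotient q) *
        (QuotientGroup.mk g)⁻¹ :=
  rfl

/-- `(ccnConj g, geomConj (q g))` is a morphism of extensions: the projection intertwines the
conjugations. [cite: MochizukiAbsTopIII2015, Prop 1.4 (ii) p.31] -/
theorem deltaCcnProjₜ_ccnConj (g : E.arith) (y : DeltaCcn q) :
    deltaCcnProjₜ q (ccnConj q g y) = geomConj F (q.arith g) (deltaCcnProjₜ q y) := by
  apply Subtype.ext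
  rw [coe_geomConj_apply, deltaCcnProjₜ_apply, deltaCcnProjₜ_apply, coe_deltaCcnProj,
    coe_deltaCcnProj, coe_ccnConj_apply, map_mul, map_mul, map_inv, ccnProj_mk]

/-- The induced map on the kernel, `a ↦ ḡ a ḡ⁻¹` (abc-iut-L4-t16's `extKerMap`).
[cite: MochizukiAbsTopIII2015, Prop 1.4 (ii) p.31] -/
abbrev extKerConj (g : E.arith) :
    Additive (ContinuousCohomology.extKer (deltaCcnProjₜ q)) →ₜ+
      Additive (ContinuousCohomology.extKer (deltaCcnProjₜ q)) :=
  ContinuousCohomology.extKerMap (deltaCcnProjₜ q) (deltaCcnProjₜ q) (ccnConj q g)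
    (geomConj F (q.arith g)) (deltaCcnProjₜ_ccnConj q g)

/-- Transport of the transgression along an equality of test homomorphisms (technical).
[cite: MochizukiAbsTopIII2015, Prop 1.4 (ii) p.31] -/
private theorem transgression_congr_hom {B' G' : Type u} [Group B'] [TopologicalSpace B']
    [IsTopologicalGroup B'] [Group G'] [TopologicalSpace G'] [IsTopologicalGroup G']
    {E' : Type u} [Group E'] [TopologicalSpace E'] [IsTopologicalGroup E'] (q' : E' →ₜ* B')
    {φ φ' : G' →ₜ* B'} (hφ : φ = φ') (t : C(G', E')) (ht : ∀ g, q' (t g) = φ g)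
    (ht' : ∀ g, q' (t g) = φ' g) (hA : ∀ a ∈ ContinuousCohomology.extKer q', ∀ e : E', e * a = a * e)
    (χ : Additive (ContinuousCohomology.extKer q') →ₜ+ Λ) :
    ContinuousCohomology.transgression q' φ t ht hA χ =
      ContinuousCohomology.transgression q' φ' t ht' hA χ := by
  subst hφ
  rfl

/-- **Equivariance of the differential**: `H²(c_{q g}) (d_s χ) = d_s (χ ∘ conj_ḡ)` for `g ∈ Π_{U_x}`
(abc-iut-L4-t16's naturality of the transgression — pull-back along `c_{q g}`, independence of the
lift, push-forward along `(conj_ḡ, c_{q g})` — specialised to the c-cn extension).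
[cite: MochizukiAbsTopIII2015, Prop 1.4 (ii) p.31] -/
theorem geomH2Map_ccnTransgression (s : CcnSection q) (g : E.arith)
    (χ : Additive (ContinuousCohomology.extKer (deltaCcnProjₜ q)) →ₜ+ Λ) :
    (geomH2Map F Λ (q.arith g)).hom (ccnTransgression q Λ s χ) =
      ccnTransgression q Λ s (χ.comp (extKerConj q g)) := by
  have h1 := ContinuousCohomology.transgression_pullback (deltaCcnProjₜ q)
    (ContinuousMonoidHom.id F.geom) s.toFun (fun d => s.proj_apply d) (deltaCcn_central q)
    (geomConj F (q.arith g)) χ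
  have h2 := ContinuousCohomology.transgression_pushforward (deltaCcnProjₜ q)
    (ContinuousMonoidHom.id F.geom) s.toFun (fun d => s.proj_apply d) (deltaCcnProjₜ q)
    (ccnConj q g) (geomConj F (q.arith g)) (deltaCcnProjₜ_ccnConj q g) (deltaCcn_central q)
    (deltaCcn_central q) χ
  have hφ : (ContinuousMonoidHom.id F.geom).comp (geomConj F (q.arith g)) =
      (geomConj F (q.arith g)).comp (ContinuousMonoidHom.id F.geom) :=
    ContinuousMonoidHom.ext fun _ => rfl
  change (ContinuousCohomology.map (geomConj F (q.arith g))
      (ContinuousCohomology.trivResHom Λ (geomConj F (q.arith g))) 2).hom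
      (ContinuousCohomology.transgression (deltaCcnProjₜ q) (ContinuousMonoidHom.id F.geom) s.toFun
        (fun d => s.proj_apply d) (deltaCcn_central q) χ) = _
  rw [h1, transgression_congr_hom Λ (deltaCcnProjₜ q) hφ _ _
    (fun d => by
      change deltaCcnProjₜ q (s.toFun (geomConj F (q.arith g) d)) = geomConj F (q.arith g) d
      exact s.proj_apply _)
    (deltaCcn_central q) χ,
    ContinuousCohomology.transgression_liftChange (deltaCcnProjₜ q)
      ((geomConj F (q.arith g)).comp (ContinuousMonoidHom.id F.geom))
      ((ccnConj q g).toContinuousMap.comp s.toFun)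
      (ContinuousCohomology.lift_push (deltaCcnProjₜ q) (ContinuousMonoidHom.id F.geom) s.toFun
        (fun d => s.proj_apply d) (deltaCcnProjₜ q) (ccnConj q g) (geomConj F (q.arith g))
        (deltaCcnProjₜ_ccnConj q g))
      (deltaCcn_central q) _ _ χ,
    h2]
  rfl

variable {q} {I : Subgroup E.arith}

/-- Conjugation on the kernel matches conjugation on `I_x`: `conj_ḡ(ι i) = ι(g i g⁻¹)`.
[cite: MochizukiAbsTopIII2015, Prop 1.4 (ii) p.31] -/
theorem extKerConj_inertiaToExtKer (hI : I ≤ cuspidalKernel q) (g : E.arith) (i : I)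
    (hgi : g * i * g⁻¹ ∈ I) :
    extKerConj q g (Additive.ofMul (inertiaToExtKer hI i)) =
      Additive.ofMul (inertiaToExtKer hI ⟨g * i * g⁻¹, hgi⟩) := by
  apply Additive.toMul.injective
  apply Subtype.ext
  apply Subtype.ext
  change (QuotientGroup.mk g : CuspidallyCentralQuotient q) * QuotientGroup.mk (i : E.arith) *
      (QuotientGroup.mk g)⁻¹ = QuotientGroup.mk (g * i * g⁻¹)
  rw [QuotientGroup.mk_mul, QuotientGroup.mk_mul, QuotientGroup.mk_inv]

/-- **The synchronization `I_x → M_X` is `Π_{U_x}`-EQUIVARIANT** (for `g` normalizing `I_x`, e.g.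
`g ∈ D_x`): `sync(g i g⁻¹) = g · sync(i)`, where `Π_{U_x}` acts on `M_X = Hom(H²(Δ_X, Ẑ), Ẑ)` through
`Π_{U_x} → Π_X` and `H²(c_g)` (`geomCyclotomeDualMap`).  This is the naturality underlying "the natural
isomorphisms `I_z ⥲ μ_Ẑ(Π_U) := M_Z`" of Thm. 1.9 (b) — PROVED (from the equivariance of the
differential); only the bijectivity (`Prop_1_4_ii_transgression`) remains a named fact.
[cite: MochizukiAbsTopIII2015, Thm 1.9 (b) p.37] -/
theorem inertiaSynchronization_conj (hI : I ≤ cuspidalKernel q) (s : CcnSection q)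
    (hd : Function.Bijective (ccnTransgression q ZHatCoeff.{u} s)) (g : E.arith) (i : I)
    (hgi : g * i * g⁻¹ ∈ I) :
    inertiaSynchronization q hI s hd (Additive.ofMul ⟨g * i * g⁻¹, hgi⟩) =
      geomCyclotomeDualMap F ZHatCoeff.{u} (q.arith g)
        (inertiaSynchronization q hI s hd (Additive.ofMul i)) := by
  apply LinearMap.ext
  intro ξ
  rw [geomCyclotomeDualMap_apply, inertiaSynchronization_apply, inertiaSynchronization_apply,
    ← extKerConj_inertiaToExtKer hI g i hgi]
  have key : (AddEquiv.ofBijective _ hd).symm ((geomH2Map F ZHatCoeff.{u} (q.arith g)).hom ξ) =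
      ((AddEquiv.ofBijective _ hd).symm ξ).comp (extKerConj q g) := by
    apply (AddEquiv.ofBijective _ hd).injective
    rw [AddEquiv.apply_symm_apply]
    change _ = ccnTransgression q ZHatCoeff.{u} s
      (((AddEquiv.ofBijective _ hd).symm ξ).comp (extKerConj q g))
    rw [← geomH2Map_ccnTransgression]
    change (geomH2Map F ZHatCoeff.{u} (q.arith g)).hom ξ = (geomH2Map F ZHatCoeff.{u} (q.arith g)).hom
      ((AddEquiv.ofBijective _ hd) ((AddEquiv.ofBijective _ hd).symm ξ))
    rw [AddEquiv.apply_symm_apply]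
  rw [key]
  rfl

end Equivariance

end Literature.AnabelianGeometry.AbsoluteAnabelian.AbsTopIII
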